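import Mathlib.Probability.Independence.Conditional
import Mathlib.Topology.MetricSpace.Thickening
import Literature.MathematicalPhysics.QuantumLattice.RandomField
import HarnessLib

/-!
# The germ-Markov property of a random field (McKean, Pitt, Kotani, Rozanov)

Notion requested by route `CriticalPhenomena/AnomalousForcesInteraction` (crux `GaussianLimitIsFree`,
foreseen split `MarkovRigidity` / `MarkovInheritance`): the Markov property of a probability law `μ`
on field configurations `FieldConfig E = 𝓢(E, ℝ) →Lₚₜ[ℝ] ℝ` (file `RandomField`), in the *germ* form
of McKean (1963), Kotani (1973, Def. 1) and Rozanov (1982, Ch. 2 §1.3 (1.28), §3.3 (3.14)–(3.16)).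

* `fieldSigma U` — the σ-algebra `𝒜(U)` of the region `U ⊆ E`: generated by the evaluations
  `ω ↦ ω f` at test functions `f` with `tsupport f ⊆ U` (Rozanov's random field of a generalized
  random function, Ch. 2 §1.3; used for open `U`).
* `germSigma A = ⨅ ε > 0, fieldSigma (Metric.thickening ε A)` — the germ σ-algebra
  `𝒜₊(A) = ⋂_ε 𝒜(A^ε)` of an arbitrary set `A` (Rozanov Ch. 2 §1.3; Kotani's
  `H(F) = ⋂ {H(G) : G open ⊇ F}`, F closed, in Hilbert-space form).
* `CondIndepCondExp m' m₁ m₂ μ` — "`m'` splits `m₁` and `m₂`" (Rozanov Ch. 2 §1.1 (1.1)):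
  `μ⟦s ∩ t | m'⟧ =ᵐ[μ] μ⟦s | m'⟧ * μ⟦t | m'⟧` for `s ∈ m₁`, `t ∈ m₂`; this is *literally* the
  right-hand side of Mathlib's `ProbabilityTheory.condIndep_iff` (`condIndepCondExp_iff_condIndep`).
* `IsGermMarkovLaw μ` — for every bounded open `T ⊆ E`, the germ σ-algebra `𝒜₊(∂T)` of the
  boundary splits `𝒜₊(T̄)` (the field in the closure, Kotani's `H₋(T) = H(T̄)`) and `𝒜₊(Tᶜ)` (the
  field in the closed complement, `H₊(T) = H(Tᶜ)`).

## Sources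

* S. Kotani, *On a Markov property for stationary Gaussian processes with a multidimensional
  parameter*, Proc. 2nd Japan–USSR Symp. Probab., LNM 330 (1973) 239–250: Def. 1 (p. 244: for every
  bounded open `T`, `P_{H₋(T)} H₊(T) = ∂H(T)` with `H₋(T) = H(T̄)`, `H₊(T) = H(Tᶜ)`,
  `∂H(T) = H(∂T)`), attributed there to McKean and Pitt, with the remark that McKean's definition is
  stated in terms of σ-fields and that for Gaussian processes it can be given in terms of the space
  `H`; Thm 2 (p. 240: Markovian ⟺ `σ⁻¹` is the restriction of an entire function of minimal
  exponential type) is the rigidity statement the route consumes.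
* Yu. A. Rozanov, *Markov Random Fields*, Springer 1982. Ch. 2 §1.1 (1.1): splitting σ-algebras.
  Ch. 2 §1.3: random fields `𝒜(S)`, `S` open, the generalized-random-function example (`𝒜(S)`
  generated by `(u, ξ)`, `Supp u ⊆ S`), `𝒜₊(S) = ⋂_ε 𝒜(S^ε)`, and the Markov property: Rozanov's
  DEFINITION (1.26)–(1.27) asks that the collars `𝒜(Γ^ε)` split `𝒜(S)` and `𝒜(T ∖ S̄)` for all
  small `ε`; he then derives (1.28) that `𝒜₊(Γ)` splits `𝒜₊(S ∪ Γ) = 𝒜₊(S̄)` and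
  `𝒜₊((T ∖ S̄) ∪ Γ) = 𝒜₊(Sᶜ)` — the germ form defined here — and (1.29) that `𝒜₊(Γ)` splits the
  sharp `𝒜(S)`, `𝒜(T ∖ S̄)`; the converse holds under his (1.30) and fails in general (derivative
  of white noise, loc. cit.). Ch. 2 §3.3: for Gaussian fields the germ form is (3.14), expressed as
  `P(H₊(S₁ ∪ Γ)) H₊(S₂ ∪ Γ) = H₊(Γ)` (3.16) — Kotani's Def. 1 verbatim — and "in general, conditions
  (3.14) are weaker than (3.10), (3.12) but they are equivalent under (3.15)". Ch. 3 §2.3, Theorem: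
  a stationary generalized function with spectral density `f` (satisfying (2.19)) is Markov iff
  `1/f` is a polynomial; its necessity half uses only (3.14) (Ch. 3 §1.3).
* Yu. A. Rozanov, *Boundary problems for stochastic partial differential equations*, in: Stochastic
  Processes — Mathematics and Physics II (BiBoS 1985), LNM 1250 (1987), §1, §4 (same formulation).
* H. P. McKean Jr., *Brownian motion with a several-dimensional time*, Teor. Verojatn. Primen. 8
  (1963) 357–378 (origin of the germ / "splitting" field); L. D. Pitt, *A Markov property for
  Gaussian processes with a multidimensional parameter*, ARMA 43 (1971) 367–391 (not consulted).

## Mathlib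

Used: `ProbabilityTheory.condIndep_iff` (bridge), `MeasureTheory.condExp` and the notation
`μ⟦s | m⟧` (`open scoped ProbabilityTheory`), `MeasurableSpace.comap`, the complete lattice of
σ-algebras, `Metric.thickening`. Mathlib's `ProbabilityTheory.CondIndep` is defined through
`condExpKernel` and therefore demands `[StandardBorelSpace Ω]`; `FieldConfig E` (weak-* dual of
Schwartz space with its Borel σ-algebra) has no such instance in Mathlib (mathematically `𝒮'(ℝᵈ)`
is a Lusin space, so its Borel σ-algebra *is* standard, but this is far from the library), hence the
definition is phrased through `condIndep_iff`'s right-hand side, which needs no such instance, and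
`isGermMarkovLaw_iff_condIndep` records the equivalence with Mathlib's notion whenever the instance
is available. Verified absent at the pin: any Markov / germ-field notion for random fields over a
continuum (`lean search 'GermMarkov|IsMarkovField|germSigma'`), any kernel-free conditional
independence predicate.

## Design and caveats

* Germ σ-algebras are intersections over metric `ε`-thickenings (Rozanov, McKean); for a compact
  set (e.g. `frontier T`, `closure T` when `E` is finite-dimensional) this is the same as Kotani's
  intersection over all open neighbourhoods, and likewise for `Tᶜ` with `T` bounded open in finite
  dimension (an open `G ⊇ Tᶜ` has compact complement inside `T`, hence contains a thickening of
  `Tᶜ`). Everything is stated for a general real normed space `E` as in `RandomField`; consumers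
  take `E = EuclideanSpace ℝ (Fin d)`.
* THREE neighbouring formulations exist (Rozanov Ch. 2 §1.3, §3.3): (R) Rozanov's definition
  (1.27)/(3.10) — every small collar `𝒜(∂T^ε)` splits `𝒜(T)` and `𝒜(T̄ᶜ)`; (K) the germ form
  (1.28)/(3.14)/(3.16) = Kotani's Def. 1 — `𝒜₊(∂T)` splits `𝒜₊(T̄)` and `𝒜₊(Tᶜ)`; (P) the sharp
  form (1.29) — `𝒜₊(∂T)` splits `𝒜(T)` and `𝒜(T̄ᶜ)` (the wording of the definition request). As
  printed: (R) ⟹ (K) ⟹ (P), with converses under (1.30)/(3.15) only. `IsGermMarkovLaw` is (K):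
  it is the hypothesis of Kotani's Thm 2 and of the necessity half of Rozanov's Ch. 3 §2.3 theorem,
  and it is implied by (R). (P) is proved from it (`IsGermMarkovLaw.sharp`); (R) is not defined here.
* For a Gaussian law, splitting of the σ-algebras generated by Gaussian subspaces is splitting of
  the subspaces (Rozanov Ch. 2 §3.1 (3.3)), which is how (K) becomes Kotani's projection identity;
  that transcription is not formalised here.
* Junk: `IsGermMarkovLaw μ` is meant for probability laws. Mathlib's `condExp` is the junk value
  `0` when `μ.trim` is not σ-finite on the conditioning σ-algebra, which makes the condition vacuous
  for such measures (e.g. some infinite measures); consumers assume `[IsProbabilityMeasure μ]`, as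
  for the other predicates of `RandomField`. For `T = ∅` (or `frontier T = ∅`) the condition is
  trivially true, as it should be. A Dirac law (deterministic field) satisfies it (checked in a
  scratch file, not shipped).
* Not here: formulation (R), the equivalent one-sided / minimal-splitting variants (Rozanov
  (1.31)–(1.34)), Kotani's Thm 2 / Rozanov's spectral criterion (to be vendored as named facts on
  top of this notion).
-/

open scoped SchwartzMap ProbabilityTheory
open MeasureTheory ProbabilityTheory

namespace Literature.MathematicalPhysics.QuantumLattice

/-! ### Conditional independence of σ-algebras, conditional-expectation form -/

section CondIndep

variable {Ω : Type*}

/-- Conditional independence of two σ-algebras `m₁`, `m₂` given a third `m'`, under the measure `μ`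
(on the ambient σ-algebra `mΩ`) — "`m'` *splits* `m₁` and `m₂`" (Rozanov): for all `s ∈ m₁` and
`t ∈ m₂`, `μ⟦s ∩ t | m'⟧ = μ⟦s | m'⟧ · μ⟦t | m'⟧` almost everywhere, where `μ⟦s | m'⟧ = μ[𝟙ₛ | m']`
is the conditional probability. This is literally the right-hand side of Mathlib's
`ProbabilityTheory.condIndep_iff`, usable without the `StandardBorelSpace Ω` instance that
`ProbabilityTheory.CondIndep` requires (see `condIndepCondExp_iff_condIndep`).
[cite: Rozanov1982, Ch. 2 §1.1 (1.1)] -/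
def CondIndepCondExp (m' m₁ m₂ : MeasurableSpace Ω) {mΩ : MeasurableSpace Ω} (μ : Measure Ω) :
    Prop :=
  ∀ s t : Set Ω, MeasurableSet[m₁] s → MeasurableSet[m₂] t →
    μ⟦s ∩ t | m'⟧ =ᵐ[μ] μ⟦s | m'⟧ * μ⟦t | m'⟧

/-- Splitting is symmetric in the two split σ-algebras. [folklore] -/
theorem CondIndepCondExp.symm {m' m₁ m₂ : MeasurableSpace Ω} {_mΩ : MeasurableSpace Ω}
    {μ : Measure Ω} (h : CondIndepCondExp m' m₁ m₂ μ) : CondIndepCondExp m' m₂ m₁ μ := by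
  intro s t hs ht
  simpa only [Set.inter_comm, mul_comm] using h t s ht hs

/-- Conditional independence given `m'` is inherited by sub-σ-algebras of the two split
σ-algebras. [folklore] -/
theorem CondIndepCondExp.mono {m' m₁ m₂ n₁ n₂ : MeasurableSpace Ω} {_mΩ : MeasurableSpace Ω}
    {μ : Measure Ω} (h : CondIndepCondExp m' m₁ m₂ μ) (h₁ : n₁ ≤ m₁) (h₂ : n₂ ≤ m₂) :
    CondIndepCondExp m' n₁ n₂ μ :=
  fun s t hs ht => h s t (h₁ s hs) (h₂ t ht)

/-- On a standard Borel space and for a finite measure, the conditional-expectation form of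
conditional independence *is* Mathlib's `ProbabilityTheory.CondIndep`
(`ProbabilityTheory.condIndep_iff`). [folklore] -/
theorem condIndepCondExp_iff_condIndep {m' m₁ m₂ : MeasurableSpace Ω} {mΩ : MeasurableSpace Ω}
    [StandardBorelSpace Ω] (hm' : m' ≤ mΩ) (hm₁ : m₁ ≤ mΩ) (hm₂ : m₂ ≤ mΩ) (μ : Measure Ω)
    [IsFiniteMeasure μ] : CondIndepCondExp m' m₁ m₂ μ ↔ CondIndep m' m₁ m₂ hm' μ :=
  (condIndep_iff m' m₁ m₂ hm' hm₁ hm₂ μ).symm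

end CondIndep

/-! ### σ-algebras of regions and germ σ-algebras -/

variable {E : Type*} [NormedAddCommGroup E] [NormedSpace ℝ E]

/-- The σ-algebra `𝒜(U)` of the region `U ⊆ E` of a random field: the smallest σ-algebra on
`FieldConfig E` making every evaluation `ω ↦ ω f` with `tsupport f ⊆ U` measurable (Rozanov's
random field of a generalized random function: `𝒜(S)` generated by `(u, ξ)`, `Supp u ⊆ S`, `S`
open; Kotani's `H(G)`, `G` open, in Hilbert-space form). Intended for open `U`.
[cite: Rozanov1982, Ch. 2 §1.3] -/
@[reducible] noncomputable def fieldSigma (U : Set E) : MeasurableSpace (FieldConfig E) :=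
  ⨆ f : {f : 𝓢(E, ℝ) // tsupport f ⊆ U},
    MeasurableSpace.comap (fun ω : FieldConfig E => ω f.1) inferInstance

/-- The *germ* σ-algebra `𝒜₊(A) = ⋂_{ε > 0} 𝒜(A^ε)` of a set `A ⊆ E`: the events generated by the
field in every `ε`-neighbourhood of `A` (Rozanov; McKean's germ field; Kotani's
`H(F) = ⋂ {H(G) : G ⊇ F open}` for closed `F`). [cite: Rozanov1982, Ch. 2 §1.3 (1.28)] -/
@[reducible] noncomputable def germSigma (A : Set E) : MeasurableSpace (FieldConfig E) :=
  ⨅ ε : {ε : ℝ // 0 < ε}, fieldSigma (Metric.thickening ε.1 A)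

/-- `fieldSigma` is monotone in the region (Rozanov (1.25)). [folklore] -/
theorem fieldSigma_mono {U V : Set E} (h : U ⊆ V) : fieldSigma U ≤ fieldSigma V :=
  iSup_le fun f => le_iSup_of_le ⟨f.1, f.2.trans h⟩ le_rfl

/-- An evaluation at a test function supported in `U` is `fieldSigma U`-measurable. [folklore] -/
theorem measurable_eval_fieldSigma {U : Set E} {f : 𝓢(E, ℝ)} (hf : tsupport f ⊆ U) :
    Measurable[fieldSigma U] fun ω : FieldConfig E => ω f :=
  measurable_iff_comap_le.2 (le_iSup_of_le ⟨f, hf⟩ le_rfl)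

/-- Every region σ-algebra is a sub-σ-algebra of the Borel σ-algebra of `FieldConfig E`
(evaluations are weak-* continuous). [folklore] -/
theorem fieldSigma_le (U : Set E) : fieldSigma U ≤ FieldConfig.instMeasurableSpace (E := E) :=
  iSup_le fun f => (measurable_eval f.1).comap_le

/-- The germ σ-algebra of `A` is contained in the σ-algebra of each `ε`-neighbourhood of `A`.
[folklore] -/
theorem germSigma_le_fieldSigma_thickening (A : Set E) {ε : ℝ} (hε : 0 < ε) :
    germSigma A ≤ fieldSigma (Metric.thickening ε A) :=
  iInf_le_of_le ⟨ε, hε⟩ le_rfl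

/-- The sharp σ-algebra of a set is contained in its germ σ-algebra. [folklore] -/
theorem fieldSigma_le_germSigma (A : Set E) : fieldSigma A ≤ germSigma A :=
  le_iInf fun ε => fieldSigma_mono (Metric.self_subset_thickening ε.2 A)

/-- `germSigma` is monotone in the set. [folklore] -/
theorem germSigma_mono {A B : Set E} (h : A ⊆ B) : germSigma A ≤ germSigma B :=
  le_iInf fun ε => (iInf_le _ ε).trans (fieldSigma_mono (Metric.thickening_subset_of_subset _ h))

/-- The germ σ-algebra only depends on the closure of the set. [folklore] -/
theorem germSigma_closure (A : Set E) : germSigma (closure A) = germSigma A := by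
  simp only [germSigma, Metric.thickening_closure]

/-- Every germ σ-algebra is a sub-σ-algebra of the Borel σ-algebra of `FieldConfig E`. [folklore] -/
theorem germSigma_le (A : Set E) : germSigma A ≤ FieldConfig.instMeasurableSpace (E := E) :=
  (germSigma_le_fieldSigma_thickening A one_pos).trans (fieldSigma_le _)

/-! ### The germ-Markov property -/

/-- The **germ-Markov property** of a law `μ` on field configurations over `E` (McKean 1963;
Kotani 1973, Def. 1; Rozanov 1982, Ch. 2 (1.28)/(3.14)): for every bounded open `T ⊆ E`, the germ
σ-algebra `𝒜₊(T̄)` of the closure (the field in `T̄`, Kotani's `H₋(T) = H(T̄)`) and the germ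
σ-algebra `𝒜₊(Tᶜ)` of the complement (the field outside `T`, `H₊(T) = H(Tᶜ)`) are conditionally
independent given the germ σ-algebra `𝒜₊(∂T) = ⋂_{ε>0} σ(ω f : tsupport f ⊆ (∂T)^ε)` of the
boundary (`∂H(T) = H(∂T)`). Kotani prints it for centred stationary Gaussian processes in the
Hilbert-space form `P_{H₋(T)} H₊(T) = ∂H(T)` (= Rozanov's (3.16)), attributing the σ-field form
to McKean. It is implied by Rozanov's own (collar) definition (1.27) and implies the sharp form
(1.29) (`IsGermMarkovLaw.sharp`); see the module docstring. Conditional independence is in the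
splitting form `CondIndepCondExp` (= Mathlib's `CondIndep` on standard Borel spaces,
`isGermMarkovLaw_iff_condIndep`). Intended for probability laws (module docstring: `condExp` junk
value on non-σ-finite measures). [cite: Kotani1973, Def. 1, p. 244] -/
def IsGermMarkovLaw (μ : Measure (FieldConfig E)) : Prop :=
  ∀ T : Set E, IsOpen T → Bornology.IsBounded T →
    CondIndepCondExp (germSigma (frontier T)) (germSigma (closure T)) (germSigma Tᶜ) μ

/-- Unfolding lemma for `IsGermMarkovLaw`. [folklore] -/
theorem isGermMarkovLaw_iff (μ : Measure (FieldConfig E)) :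
    IsGermMarkovLaw μ ↔ ∀ T : Set E, IsOpen T → Bornology.IsBounded T →
      ∀ s t : Set (FieldConfig E), MeasurableSet[germSigma (closure T)] s →
        MeasurableSet[germSigma Tᶜ] t →
          μ⟦s ∩ t | germSigma (frontier T)⟧ =ᵐ[μ]
            μ⟦s | germSigma (frontier T)⟧ * μ⟦t | germSigma (frontier T)⟧ :=
  Iff.rfl

/-- The germ-Markov property implies the variant with *sharp* interior and exterior σ-algebras
(Rozanov 1982, Ch. 2 §1.3 (1.29); the wording of the definition request): for every bounded open
`T`, `σ(ω f : tsupport f ⊆ T)` and `σ(ω f : tsupport f ⊆ (closure T)ᶜ)` are conditionally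
independent given the germ σ-algebra of `frontier T` (monotonicity, since `T ⊆ T̄ ⊆ T̄^ε` and
`(T̄)ᶜ ⊆ Tᶜ ⊆ (Tᶜ)^ε`). [folklore] -/
theorem IsGermMarkovLaw.sharp {μ : Measure (FieldConfig E)} (h : IsGermMarkovLaw μ) {T : Set E}
    (hT : IsOpen T) (hb : Bornology.IsBounded T) :
    CondIndepCondExp (germSigma (frontier T)) (fieldSigma T) (fieldSigma (closure T)ᶜ) μ :=
  (h T hT hb).mono ((fieldSigma_mono subset_closure).trans (fieldSigma_le_germSigma _))
    ((fieldSigma_mono (Set.compl_subset_compl.2 subset_closure)).trans (fieldSigma_le_germSigma _))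

/-- The two split σ-algebras may be swapped: the field outside `T` and the field in `T̄` are
conditionally independent given the germ of the boundary (Rozanov (3.16a)). [folklore] -/
theorem IsGermMarkovLaw.symm {μ : Measure (FieldConfig E)} (h : IsGermMarkovLaw μ) {T : Set E}
    (hT : IsOpen T) (hb : Bornology.IsBounded T) :
    CondIndepCondExp (germSigma (frontier T)) (germSigma Tᶜ) (germSigma (closure T)) μ :=
  (h T hT hb).symm

/-- Whenever `FieldConfig E` is known to be standard Borel (true for `E = ℝᵈ`, not in Mathlib) and
`μ` is finite, `IsGermMarkovLaw μ` is conditional independence in Mathlib's sense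
`ProbabilityTheory.CondIndep` of the germ σ-algebras of `closure T` and `Tᶜ` given that of
`frontier T`, for every bounded open `T`. [folklore] -/
theorem isGermMarkovLaw_iff_condIndep [StandardBorelSpace (FieldConfig E)]
    (μ : Measure (FieldConfig E)) [IsFiniteMeasure μ] :
    IsGermMarkovLaw μ ↔ ∀ T : Set E, IsOpen T → Bornology.IsBounded T →
      CondIndep (germSigma (frontier T)) (germSigma (closure T)) (germSigma Tᶜ)
        (germSigma_le (frontier T)) μ := by
  simp only [IsGermMarkovLaw, condIndepCondExp_iff_condIndep (germSigma_le _) (germSigma_le _)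
    (germSigma_le _) μ]

end Literature.MathematicalPhysics.QuantumLattice
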